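import Summits.BirchSwinnertonDyer.Rank1Residual.Additive.SignedTwistLocalDictionary
import HarnessLib

/-!
# Odd layers of the signed twist: `[K₀ℚ_k·E : ℚ_k·E] • W(ℚ_k·E) ⊆ E^{−,0}_W(k) + W(ℚ_{k−1}·E)`
# from `hsum`, and the `p`-divisibility of `W(ℚ_k·E)/W(ℚ_{k−1}·E)` in the absence of witnesses
# (cell `b2b-bsdres`, CLASS-CLOSURE lane, class O10 — x1b GEN 40, class lead; file 89 of the series)

HONEST FRAMING (cell `b2b-bsdres`, run/shared/lean/b2b/bsd-rank1-residual/, verbatim in every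
file): the goal of the cell is to DELETE the COMBINATION-SHAPED residual classes of the
Birch–Swinnerton-Dyer formula for ALL analytic-rank `≤ 1` elliptic curves over `ℚ` — "full BSD
formula for every rank `≤ 1` curve in class `C`" assembled STRICTLY from published theorems — so
that the rank-`≤ 1` remainder becomes exactly the CONSTRUCTION-SHAPED classes, which are TYPED
(missing-input `Prop`s), NOT attempted. This is not "finishing BSD". CLASS-CLOSURE lane: prove
what is provable now; shrink each hard class to its core with data; no claim beyond stated classes;
research routes on CONSTRUCTION-SHAPED X12 / O10; census / instrument output = EVIDENCE / conjecture
items, NEVER a Literature fact; `RESIDUAL-MAP.md` marks change only by signed lines. THIS FILE: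
TOOL THEOREMS ONLY — no definition, no named Literature fact, no `sorry`, axioms standard; nothing
is booked; no label / mark / count / sub-cell moves; (C1_η), (C2_η-GZ), (C3_η) stay typed as filed
(cc-typer-6's pen); nothing about `BSD(W, p)` of any pair is claimed.

## What (binders of n1011-p17's dictionary (P5-2b/2c): `Ψ = localTransport … ι : W(ℚ̄_E) ≃ V(ℚ̄_E)`,
## `V = C • W^{(c)}`, `K₀ ∋ θ = √c`, `η` the character of `θ`, `κ` a `ℤ_p`-extension of `ℚ`,
## `W_j = W(ℚ_j·E)`, `N_k = E⁻_W(ℚ_k·E) ∩ ker Tr_{k/0}` the zero-clause minus group of file 81)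

The WITNESS input of brick B3 (files 79–82; x1b GEN 39 note §3 (i)) at a layer `k` is a point of
`N_k` outside `p·W_k + W_{k−1}`. This file is the `W`-side ALGEBRA of its existence proof:

* §1 `towerSigned_one_le_localFixedPointsOfEmb_of_odd`: for ODD `k`, `E⁺(K_{k,v}) ≤ E(K_{k−1,v})`
  (Def. 1.1: the plus condition at `m = k − 1` reads `Tr_{k/k} P = P ∈ E(K_{k−1,v})`);
  `index_subgroupOf_tower_layer_dvd`: the local degree `d = [K₀ℚ_k·E : ℚ_k·E]` divides `[K₀ : ℚ]`.
* §2 **`exists_index_smul_eq_zeroClause_add_of_odd`**: under (D0), `κ(Gal(ℚ̄/K₀)) = ℤ_p`,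
  `Gal(ℚ̄/K₀) ⊴ Γ_ℚ` and `hsum` at layer `k` (`E(K_{k,v}) = E⁺ + E⁻`, Prop. 8.12 ii) — kernel for
  the cyclotomic tower), for odd `k` and every `Q ∈ W_k`: **`d • Q ∈ N_k + W_{k−1}`**. Proof:
  `Ψ Q = A + B`, `A ∈ E⁺ ⊆ E(K_{k−1,v})`, `B ∈ E⁻`; the trace `T = Tr_{K₀ℚ_k·E/ℚ_k·E}` gives
  `T Q = d • Q`, `T(Ψ⁻¹B) ∈ N_k` (the η-average (D4b3)), and `T(Ψ⁻¹A)` is fixed by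
  `Gal(ℚ̄_E/ℚ_k·E)` and by `Gal(ℚ̄_E/K₀ℚ_{k−1}·E)`, hence by `Gal(ℚ̄_E/ℚ_{k−1}·E)` ((D0)(i)).
* §3 **`exists_eq_smul_add_of_forall_zeroClause`**: if moreover `[K₀ : ℚ] ≤ p − 1` (so `p ∤ d`) and
  NO point of `N_k` is a witness (`N_k ⊆ p·W_k + W_{k−1}`), then `W_k ⊆ p·W_k + W_{k−1}` (Bezout).
  File 90 refutes this conclusion with the layer descent of file 87 and the test element of file 88.

References: [Kobayashi2003] S. Kobayashi, Invent. Math. 152 (2003), §2 p. 4, Def. 1.1, Prop. 8.12;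
[GreenbergLNM1716] §2 (decomposition groups along an embedding).
-/

noncomputable section

open scoped Classical

open WeierstrassCurve Field

namespace Summit.BirchSwinnertonDyer.Rank1Residual.Additive.SignedTwist

open Literature.NumberTheory.EllipticCurves Literature.NumberTheory.GaloisRepresentations
  Literature.NumberTheory.EllipticCurves.Kobayashi2003
  Summit.BirchSwinnertonDyer.Rank1Residual.AdditivePotMult

universe u

/-! ## §1 Two generic tower facts -/

section Generic

open ZpExtension

variable {K : Type u} [Field K] {E : Type u} [Field E] [Algebra K E]
  (ι : AlgebraicClosure K →ₐ[K] AlgebraicClosure E) (W : WeierstrassCurve K)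

/-- **`E⁺(K_{k,v}) ≤ E(K_{k−1,v})` for ODD `k`**: the plus condition at the even index `m = k − 1`
is `Tr_{k/k} P = P ∈ E(K_{k−1,v})`. [cite: Kobayashi2003, §2 p. 4, Def. 1.1] -/
theorem towerSigned_one_le_localFixedPointsOfEmb_of_odd (U : ℕ → Subgroup (absoluteGaloisGroup K))
    [∀ n, (U n).FiniteIndex] {k : ℕ} (hk : Odd k) :
    towerSignedLocalPointsOfEmb U ι W 1 k ≤ localFixedPointsOfEmb ι W (U (k - 1)) := by
  intro P hP
  obtain ⟨hPk, hPm⟩ := (mem_towerSignedLocalPointsOfEmb_one_iff U ι W k P).mp hP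
  obtain ⟨j, rfl⟩ := hk
  have h := hPm (2 * j) (by omega) (even_two_mul j)
  rw [localPairTraceOfEmb_self_of_mem ι W (U (2 * j + 1)) hPk] at h
  simpa using h

/-- **The local degree `d = [K₀K_k·E : K_k·E]` divides `[Γ_K : Gal(K̄/K₀)] = [K₀ : K]`** (for
`Gal(K̄/K₀) ⊴ Γ_K`): inside `Gal(K̄_E/K_k·E)` the subgroup over `K₀K_k` is the intersection with the
decomposition group over `K₀`. [cite: GreenbergLNM1716, §2] -/
theorem index_subgroupOf_tower_layer_dvd {p : ℕ} [Fact p.Prime] (κ : ZpExtension K p)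
    (K₀ : Type u) [Field K₀] [Algebra K K₀] [(galRange (K := K) K₀).Normal] (k : ℕ) :
    ((localSubgroupOfEmb (towerSubgroup κ K₀ k) ι).subgroupOf (localLayerSubgroupOfEmb κ ι k)).index ∣
      (galRange (K := K) K₀).index := by
  haveI : (localSubgroupOfEmb (galRange (K := K) K₀) ι).Normal := Subgroup.normal_comap _
  have h1 : localSubgroupOfEmb (towerSubgroup κ K₀ k) ι =
      localLayerSubgroupOfEmb κ ι k ⊓ localSubgroupOfEmb (galRange (K := K) K₀) ι := by
    rw [towerSubgroup, localLayerSubgroupOfEmb, localSubgroupOfEmb, localSubgroupOfEmb,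
      localSubgroupOfEmb, Subgroup.comap_inf]
  change (localSubgroupOfEmb (towerSubgroup κ K₀ k) ι).relIndex (localLayerSubgroupOfEmb κ ι k) ∣ _
  rw [h1, Subgroup.inf_relIndex_left]
  refine (Subgroup.relIndex_dvd_index_of_normal _ _).trans ?_
  rw [localSubgroupOfEmb, Subgroup.index_comap]
  exact Subgroup.relIndex_dvd_index_of_normal _ _

end Generic

/-! ## §2 Odd layers: `d • W_k ⊆ N_k + W_{k−1}` from `hsum` -/

section OddLayer

open ZpExtension

variable (W : WeierstrassCurve ℚ) (K₀ : Type) [Field K₀] [NumberField K₀] {θ : K₀} {c : ℚ}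
  (hθ : θ ∉ Set.range (algebraMap ℚ K₀)) (hc : θ ^ 2 = algebraMap ℚ K₀ c)
  {p : ℕ} [hp : Fact p.Prime] (κ : ZpExtension ℚ p)
  {V : WeierstrassCurve ℚ} {C : VariableChange ℚ} (hCV : C • W.quadraticTwist c = V)
  {E : Type} [Field E] [Algebra ℚ E] (ι : AlgebraicClosure ℚ →ₐ[ℚ] AlgebraicClosure E)
  (η : absoluteGaloisGroup ℚ →* ℤˣ)
  (hη : ∀ σ : absoluteGaloisGroup ℚ, η σ = 1 ↔ σ • rootInClosure K₀ θ = rootInClosure K₀ θ)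

include hθ hc hCV hη in
/-- **`d • W_k ⊆ N_k + W_{k−1}` at an ODD layer `k`** (`d = [K₀ℚ_k·E : ℚ_k·E]`,
`N_k = E⁻_W(ℚ_k·E) ∩ ker Tr_{k/0}`): given `hsum` at layer `k` on the `V`-side
(`E(K_{k,v}) ≤ E⁺(K_{k,v}) + E⁻(K_{k,v})`), every `Q ∈ W(ℚ_k·E)` satisfies
`d • Q = N + B` with `N` a zero-clause minus point and `B ∈ W(ℚ_{k−1}·E)`.
[cite: Kobayashi2003, §2 p. 4, Def. 1.1, Prop. 8.12] -/
theorem exists_index_smul_eq_zeroClause_add_of_odd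
    (hD : ∀ g : absoluteGaloisGroup ℚ, ∃ τ : absoluteGaloisGroup E,
      (resGalOfEmb ι τ)⁻¹ * g ∈ towerTopSubgroup κ K₀)
    (hκ₀ : ∀ x, ∃ g ∈ galRange (K := ℚ) K₀, κ g = x) [(galRange (K := ℚ) K₀).Normal]
    {k : ℕ} (hk : Odd k)
    (hsum : localFixedPointsOfEmb ι V (towerSubgroup κ K₀ k) ≤
      towerSignedLocalPointsOfEmb (towerSubgroup κ K₀) ι V 1 k ⊔
        towerSignedLocalPointsOfEmb (towerSubgroup κ K₀) ι V (-1) k)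
    {Q : localPoints W E} (hQ : Q ∈ localLayerPointsOfEmb κ ι W k) :
    ∃ N ∈ signedLocalPointsOfEmb κ ι W (-1) k ⊓ (localTraceOfEmb κ ι W 0 k).ker,
      ∃ B ∈ localLayerPointsOfEmb κ ι W (k - 1),
        ((localSubgroupOfEmb (towerSubgroup κ K₀ k) ι).subgroupOf
            (localLayerSubgroupOfEmb κ ι k)).index • Q = N + B := by
  set Ψ := localTransport W K₀ hθ hc hCV E ι with hΨ
  set T := localPairTraceOfEmb ι W (κ.layerSubgroup k) (towerSubgroup κ K₀ k) with hT
  -- `Ψ Q ∈ E(K_{k,v}) = E⁺ + E⁻`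
  have hΨQ : Ψ Q ∈ localFixedPointsOfEmb ι V (towerSubgroup κ K₀ k) :=
    (localTransport_mem_localFixedPoints_and_eigen W K₀ hθ hc κ hCV ι η hη hQ).1
  obtain ⟨A, hA, B', hB', hAB⟩ := AddSubgroup.mem_sup.mp (hsum hΨQ)
  -- `A ∈ E(K_{k−1,v})` (k odd)
  have hA' : A ∈ localFixedPointsOfEmb ι V (towerSubgroup κ K₀ (k - 1)) :=
    towerSigned_one_le_localFixedPointsOfEmb_of_odd ι V (towerSubgroup κ K₀) hk hA
  -- `T Q = d • Q`
  have hQ' : Q ∈ localFixedPointsOfEmb ι W (κ.layerSubgroup k) := hQ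
  have hTQ : T Q = ((localSubgroupOfEmb (towerSubgroup κ K₀ k) ι).subgroupOf
      (localLayerSubgroupOfEmb κ ι k)).index • Q :=
    localPairTraceOfEmb_apply_of_mem_lower ι W hQ'
  -- `Q = Ψ⁻¹ A + Ψ⁻¹ B'`
  have hQeq : Q = Ψ.symm A + Ψ.symm B' := by
    rw [← map_add, hAB, hΨ, AddEquiv.symm_apply_apply]
  -- `T(Ψ⁻¹ B') ∈ N_k` (the η-average (D4b3))
  have hTB : T (Ψ.symm B') ∈ signedLocalPointsOfEmb κ ι W (-1) k ⊓ (localTraceOfEmb κ ι W 0 k).ker := by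
    obtain ⟨h1, h2⟩ := localPairTrace_localTransport_symm_mem_signed W K₀ hθ hc κ hCV ι η hη hD hκ₀ hB'
    exact AddSubgroup.mem_inf.mpr ⟨h1, (AddMonoidHom.mem_ker).mpr h2⟩
  -- `T(Ψ⁻¹ A) ∈ W_{k−1}`
  have hΨA : Ψ.symm A ∈ localFixedPointsOfEmb ι W (towerSubgroup κ K₀ (k - 1)) :=
    localTransport_symm_mem_localFixedPointsOfEmb W K₀ hθ hc hCV ι (towerSubgroup_le_galRange κ K₀ _) hA'
  have hΨAk : Ψ.symm A ∈ localFixedPointsOfEmb ι W (towerSubgroup κ K₀ k) :=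
    localFixedPointsOfEmb_antitone ι W (towerSubgroup_antitone κ K₀ (Nat.sub_le k 1)) hΨA
  have hT1 : T (Ψ.symm A) ∈ localLayerPointsOfEmb κ ι W k :=
    localPairTraceOfEmb_mem_of_mem ι W hΨAk
  have hT2 : T (Ψ.symm A) ∈ localFixedPointsOfEmb ι W (towerSubgroup κ K₀ (k - 1)) := by
    rw [mem_localFixedPointsOfEmb_iff]
    intro τ hτ
    rw [hT, ← localPairTraceOfEmb_smul ι W τ hΨAk, (mem_localFixedPointsOfEmb_iff ι W _ _).mp hΨA τ hτ]
  have hTA : T (Ψ.symm A) ∈ localLayerPointsOfEmb κ ι W (k - 1) :=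
    mem_localLayerPointsOfEmb_of_tower_of_ker W K₀ κ ι hD hκ₀ hT2
      (mem_localFixedPointsOfEmb_ker_of_mem_layer W κ ι hT1)
  refine ⟨T (Ψ.symm B'), hTB, T (Ψ.symm A), hTA, ?_⟩
  rw [← hTQ, hQeq, map_add, add_comm]

/-! ## §3 No witness ⟹ `W_k ⊆ p·W_k + W_{k−1}` -/

include hθ hc hCV hη in
/-- **No witness at an odd layer forces `p`-divisibility modulo the lower layer.** With
`[Γ_ℚ : Gal(ℚ̄/K₀)] ≤ p − 1` (so `p ∤ d`), `hsum` at the odd layer `k`, and the NO-WITNESS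
hypothesis `N_k ⊆ p·W_k + W_{k−1}`: every `Q ∈ W_k` is `p·a + b` with `a ∈ W_k`, `b ∈ W_{k−1}`
(Bezout on `d • Q ∈ N_k + W_{k−1}`). [cite: Kobayashi2003, §2 p. 4, Def. 1.1, Prop. 8.12] -/
theorem exists_eq_smul_add_of_forall_zeroClause
    (hD : ∀ g : absoluteGaloisGroup ℚ, ∃ τ : absoluteGaloisGroup E,
      (resGalOfEmb ι τ)⁻¹ * g ∈ towerTopSubgroup κ K₀)
    (hκ₀ : ∀ x, ∃ g ∈ galRange (K := ℚ) K₀, κ g = x) [(galRange (K := ℚ) K₀).Normal]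
    (hidx : (galRange (K := ℚ) K₀).index ≤ p - 1)
    {k : ℕ} (hk : Odd k)
    (hsum : localFixedPointsOfEmb ι V (towerSubgroup κ K₀ k) ≤
      towerSignedLocalPointsOfEmb (towerSubgroup κ K₀) ι V 1 k ⊔
        towerSignedLocalPointsOfEmb (towerSubgroup κ K₀) ι V (-1) k)
    (hno : ∀ N ∈ signedLocalPointsOfEmb κ ι W (-1) k ⊓ (localTraceOfEmb κ ι W 0 k).ker,
      ∃ a ∈ localLayerPointsOfEmb κ ι W k, ∃ b ∈ localLayerPointsOfEmb κ ι W (k - 1), N = p • a + b)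
    {Q : localPoints W E} (hQ : Q ∈ localLayerPointsOfEmb κ ι W k) :
    ∃ a ∈ localLayerPointsOfEmb κ ι W k, ∃ b ∈ localLayerPointsOfEmb κ ι W (k - 1), Q = p • a + b := by
  set d := ((localSubgroupOfEmb (towerSubgroup κ K₀ k) ι).subgroupOf
    (localLayerSubgroupOfEmb κ ι k)).index with hd
  -- `p ∤ d`
  have hdvd : d ∣ (galRange (K := ℚ) K₀).index := index_subgroupOf_tower_layer_dvd ι κ K₀ k
  have hidx0 : (galRange (K := ℚ) K₀).index ≠ 0 := Subgroup.FiniteIndex.index_ne_zero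
  have hcop : Nat.Coprime d p := by
    rw [Nat.Coprime, Nat.gcd_comm, ← Nat.Coprime, Nat.Prime.coprime_iff_not_dvd hp.out]
    intro h
    have h1 : p ≤ (galRange (K := ℚ) K₀).index := Nat.le_of_dvd (Nat.pos_of_ne_zero hidx0) (h.trans hdvd)
    have h2 := hp.out.two_le
    omega
  obtain ⟨N, hN, B, hB, hdQ⟩ :=
    exists_index_smul_eq_zeroClause_add_of_odd W K₀ hθ hc κ hCV ι η hη hD hκ₀ hk hsum hQ
  obtain ⟨a₀, ha₀, b₀, hb₀, rfl⟩ := hno N hN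
  obtain ⟨α, β, hαβ⟩ := Nat.isCoprime_iff_coprime.mpr hcop
  set Wk := localLayerPointsOfEmb κ ι W k
  set Wk' := localLayerPointsOfEmb κ ι W (k - 1)
  refine ⟨α • a₀ + β • Q, Wk.add_mem (Wk.zsmul_mem ha₀ α) (Wk.zsmul_mem hQ β),
    α • (b₀ + B), Wk'.zsmul_mem (Wk'.add_mem hb₀ hB) α, ?_⟩
  have hdQ' : (d : ℤ) • Q = (p : ℤ) • a₀ + b₀ + B := by
    rw [natCast_zsmul, natCast_zsmul]; exact hdQ
  have hQ1 : Q = (α * (d : ℤ) + β * (p : ℤ)) • Q := by rw [hαβ, one_zsmul]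
  conv_lhs => rw [hQ1]
  rw [add_zsmul, mul_zsmul, mul_zsmul, hdQ', ← natCast_zsmul (α • a₀ + β • Q) p]
  module

end OddLayer

end Summit.BirchSwinnertonDyer.Rank1Residual.Additive.SignedTwist

end
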